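import Summits.CriticalPhenomena.PercolationContinuityZ3.Theses.PercBurnResprinkle
import Summits.CriticalPhenomena.PercolationContinuityZ3.Theorems.PercBurnResprinkleVacantSetPercolatesCoarsePercolates
import Summits.CriticalPhenomena.PercolationContinuityZ3.Theorems.PercBurnResprinkleVacantSetPercolatesPlaneProduct
import Summits.CriticalPhenomena.PercolationContinuityZ3.Theorems.PercBurnResprinkleVacantSetPercolatesBlockLocality
import Summits.CriticalPhenomena.PercolationContinuityZ3.Theorems.PercBurnResprinkleVacantSetPercolatesBlockMarginals
import Summits.CriticalPhenomena.PercolationContinuityZ3.Theorems.PercBurnResprinkleVacantSetPercolatesBlocksToVacant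
import Summits.CriticalPhenomena.PercolationContinuityZ3.Theorems.PercBurnResprinkleVacantSetPercolatesBlocksPercolate
import Literature.Probability.Percolation.FiniteClustersPercolationOneArm
import Literature.Probability.Percolation.SiteCrossingDuality
import Literature.Probability.Percolation.HalfSpaceBrickSeeds
import Literature.Probability.Percolation.SiteMonotonicity

/-!
# Line `sheet-plane-product` — skeleton for the crux `VacantSetPercolates` (item stmt-CriticalPhenomena-7205)

Lead: prover-line-stmt-CriticalPhenomena-7205-c1-0 (2026-08-16), RESHAPED from the planner's checked skeleton
`Cruxes/VacantSetPercolates/Lines/sheet_plane_product.lean` (planner-cruxplan, 5 stubs).  What changed and why (7 registered stubs now):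
* every registered stub is stated in TREE VOCABULARY ONLY (`bondPercolation`, `criticalProbI`, `PathIn`, `quietSet`, `planeEmb`,
  `DeterminedBy`, `openCluster`, `finiteClustersPercolate`, `rectangle`/`topSide`/`bottomSide`, `zdStarGraph`), with the line's
  objects unfolded — stub files land under `Theorems/` as pure proofs (`--supports stmt-CriticalPhenomena-7205`) and cannot import a
  skeleton, and new `def`s in `Theorems/` are review-queued;
* the planner's L/XL `stub_renormalisation` (one-scale static renormalisation with local uniqueness) is CUT at its natural
  interfaces into four registered stubs: `stub_blockLocality` (block events are determined by finite, well-separated footprints),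
  `stub_blockMarginals` (shift + coordinate-permutation symmetry of the block events), `stub_blocksPercolate` (the coarse PLANE of
  3-D blocks is a `5`-dependent bond process on `ℤ²` with high marginals, hence percolates — the tree's PROVED
  `DuminilCopinSidoraviciusTassion2016_dependentPercolation_holds 5` through the landed abstract lemma
  `CoarsePercolates.pos_of_dependent`), `stub_blocksToVacant` (deterministic gluing of good blocks by local uniqueness and the lift
  to GHK's graph `X`);
* the planner's `stub_continuity` is DERIVED in the sorry-free engine from `stub_blockLocality` (a local event's probability is a
  polynomial in `p`; `p_c(ℤ³) < 1`), and so is the planner's `stub_renormalisation` (from `stub_blocksPercolate`, `stub_blocksToVacant`,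
  translation invariance and a countable union bound).
Composition idea, objects and the two open inputs are the planner's, unchanged.

Crux (route `PercBurnResprinkle`): `∃ p ∈ (p_c(ℤ³), 1], P_p(0 lies in an infinite component of X = ℤ³[{y : C(y) finite}]) > 0`,
i.e. `p_c(ℤ³) < p_fin(3)` (Grimmett–Holroyd–Kozma 2014, open for `d = 3`).

IDEA (card `Cruxes/VacantSetPercolates/Ideas/sheet-plane-product.md`): work with the LOCAL vacant proxy `V_R = quietSet R ω`
(`V_R ⊆ W` a.s.).  The dual of "no `V_R`-crossing of the cube `[0,n]³` between two opposite faces" (`SheetEvent`) is an armed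
sheet, which must `∗`-cross EVERY parallel lattice section; sections `2R+2` apart are decided by disjoint edge slabs, so
`P_p(SheetEvent n R) ≤ P_p(PlanarArmedStarCrossing n R)^k` for `k (2R+2) ≤ n` (`stub_planeProduct`).  A one-scale static
renormalisation (good block = cube crossed by `V_R` in the three directions + no two `V_R`-giants in the tripled cube; coarse plane
of blocks; dependent percolation; gluing BY UNIQUENESS) and continuity in `p` at `p_c` reduce the crux to two finite-volume inputs
at `p_c`: (a) planar non-degeneracy `stub_planarNonDegeneracy`, (b) local uniqueness `stub_localUniqueness`.

OBJECTS (abbreviations used in this file; the registered stubs spell them out):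
* `cube n = [0,n]³`, `bigCube n = [-n,2n]³`; for a coarse site `a ∈ ℤ²` the block base point is `planeEmb 3 (n • a) = (n a₀, n a₁, 0)`,
  `cubeAt n a = planeEmb 3 (n • a) + [0,n]³`, `bigCubeAt n a = planeEmb 3 (n • a) + [-n,2n]³`;
* `SheetEvent n R` — NO lattice path of `R`-quiet sites crosses `cube n` from `{x₀ = 0}` to `{x₀ = n}`;
* `PlanarArmedStarCrossing n R` — a `∗`-path of `R`-ARMED sites crosses the section square `{x₁ = 0} ∩ cube n` from `{x₂ = n}` to `{x₂ = 0}`;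
* `CrossAt n R a i` — `cubeAt n a` IS crossed in direction `i` by a lattice path of `R`-quiet sites;
* `TGAt n R a` — TWO VACANT GIANTS in `bigCubeAt n a` (two sites, each quiet-joined inside it to sup-distance `≥ n`, not quiet-joined
  to each other inside it); `TwoVacantGiants n R` is the case `a = 0`;
* `BC n R ω` — the coarse bond configuration on `ℤ²`: a lattice edge `{a, b}` is open iff both blocks are GOOD
  (crossed in the three directions and without two giants);
* `BFP n R a` — the block footprint: the pairs with both endpoints in `planeEmb 3 (n • a) + [-n-R, 2n+R]³`.

STUBS (registered; 7 = stubs_max; after wave-1 the five provable ones are LANDED and referenced by their tree names — `sorry` remains only in the two open inputs):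
* `stub_planeProduct`        — `k (2R+2) ≤ n → P_p(SheetEvent n R) ≤ P_p(PlanarArmedStarCrossing n R)^k` (M–L, provable).
* `stub_blockLocality`       — `CrossAt`, `TGAt` determined by the finite footprint `BFP`; footprints of blocks at coarse sup-distance
  `≥ 4` are disjoint when `2R+2 ≤ n` (M, provable).
* `stub_blockMarginals`      — `P_p(¬ CrossAt n R a i) = P_p(SheetEvent n R)`, `P_p(TGAt n R a) = P_p(TwoVacantGiants n R)` (M–L, provable).
* `stub_blocksPercolate`     — ABSTRACT one-scale renormalisation: `∃ q > 0`, for any block events with finite footprints disjoint at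
  coarse distance `≥ 4`, failure probabilities `≤ q` ⇒ `P_p(0 ∈ ∞ cluster of the good-blocks process) > 0` (M, provable:
  `CoarsePercolates.pos_of_dependent`; reshaped to the abstract form after wave-1 because the concrete signature exceeded the registry cap).
* `stub_blocksToVacant`      — `1 ≤ n → ω ⊆ E(ℤ³) → 0 ∈ ∞ cluster of BC n R ω → ω ∈ finiteClustersPercolate (zdGraph 3)` (M–L, provable).
* `stub_planarNonDegeneracy` — INPUT (a), OPEN (hardest).
* `stub_localUniqueness`     — INPUT (b), OPEN.
COMPOSITION: sorry-free ENGINE (`continuous_real_sheetEvent`, `continuous_real_twoVacantGiants`, `exists_supercritical_of_lt`,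
`renormalisation`, `engine`) + `VacantSetPercolates_of` (the crux BY NAME).  The def-free composition is LANDED in the tree as
`Theorems/PercBurnResprinkleVacantSetPercolatesSheetPlaneProduct.lean` (p111789): `stub_sheetPlaneProductTransfer` /
`vacantSetPercolates_of_sheetPlaneProductInputs : (a) → (b) → VacantSetPercolates`, the `p`-agnostic criterion
`SPPComposition.renormalisation`, and the one-range sufficient form of (a), `planarNonDegeneracy_of_oneRange` /
`vacantSetPercolates_of_oneRange_of_localUniqueness`.  STATE: the crux is CLOSED ON THIS LINE MODULO (a) and (b).

DISPROOF USED (`Cruxes/VacantSetPercolates/Disproof.lean`, cdisprove cycles 1–2, read 2026-08-16 by this lead): no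
`_false_without_` theorem and no `-- Targets` section exist; honoured: §1 (the witness `p > p_c` is built from `criticalProb_zd_lt_one` +
continuity — the only load-bearing conjunct), §3 (one `p`, ALL lattice edges between vacant sites, positive probability; no refuted
strengthening is asked), §7 (`continuity_of_oneArm_decay`: no one-arm bound is assumed; `continuity_of_fullRecovery`: positivity at ONE
`p`, not full recovery), §8 `not_vacantSetPercolatesAt_two` (dimension enters through the exponent `⌊n/(2R+2)⌋` of the plane product,
void in `d = 2`).  No `Negative/` lemma has landed.
-/

namespace Summit.CriticalPhenomena.PercolationContinuityZ3.Cruxes.VacantSetPercolates.SheetPlaneProduct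

open MeasureTheory Set Filter
open scoped Topology
open Literature.Probability.Percolation Literature.Probability.LatticeModels
open Summit.CriticalPhenomena.PercolationContinuityZ3.Theses.PercBurnResprinkle (VacantSetPercolates)

noncomputable section

/-! ### Objects of the line (abbreviations; the stubs below restate them unfolded) -/

/-- The cube `[0, n]³`. -/
def cube (n : ℕ) : Set (Site 3) := {x | ∀ i, 0 ≤ x i ∧ x i ≤ (n : ℤ)}

/-- The tripled cube `[-n, 2n]³`. -/
def bigCube (n : ℕ) : Set (Site 3) := {x | ∀ i, -(n : ℤ) ≤ x i ∧ x i ≤ 2 * (n : ℤ)}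

/-- The block cube of the coarse site `a`: `planeEmb 3 (n • a) + [0, n]³`. -/
def cubeAt (n : ℕ) (a : Site 2) : Set (Site 3) :=
  {x | ∀ i, (planeEmb 3 ((n : ℤ) • a)) i ≤ x i ∧ x i ≤ (planeEmb 3 ((n : ℤ) • a)) i + (n : ℤ)}

/-- The tripled block cube of the coarse site `a`: `planeEmb 3 (n • a) + [-n, 2n]³`. -/
def bigCubeAt (n : ℕ) (a : Site 2) : Set (Site 3) :=
  {x | ∀ i, (planeEmb 3 ((n : ℤ) • a)) i - (n : ℤ) ≤ x i ∧ x i ≤ (planeEmb 3 ((n : ℤ) • a)) i + 2 * (n : ℤ)}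

/-- `SheetEvent n R`: NO lattice path of `R`-quiet sites crosses `cube n` from the face `{x₀ = 0}` to the face `{x₀ = n}`. -/
def SheetEvent (n R : ℕ) : Set (BondConfig (Site 3)) :=
  {ω | ¬ ∃ x y : Site 3, x 0 = 0 ∧ y 0 = (n : ℤ) ∧ PathIn (zdGraph 3) (quietSet R ω ∩ cube n) x y}

/-- `PlanarArmedStarCrossing n R`: a `∗`-path of `R`-armed sites of the section plane `{x₁ = 0}` crosses the square
`[0,n]²` (coordinates `x₀`, `x₂`) from the side `{x₂ = n}` to the side `{x₂ = 0}`. -/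
def PlanarArmedStarCrossing (n R : ℕ) : Set (BondConfig (Site 3)) :=
  {ω | ∃ x ∈ topSide n n, ∃ y ∈ bottomSide n n,
    PathIn zdStarGraph {z : Site 2 | z ∈ rectangle n n ∧ (![z 0, 0, z 1] : Site 3) ∉ quietSet R ω} x y}

/-- `CrossAt n R a i`: the block cube of `a` is crossed in direction `i` by a lattice path of `R`-quiet sites. -/
def CrossAt (n R : ℕ) (a : Site 2) (i : Fin 3) : Set (BondConfig (Site 3)) :=
  {ω | ∃ x y : Site 3, x i = (planeEmb 3 ((n : ℤ) • a)) i ∧ y i = (planeEmb 3 ((n : ℤ) • a)) i + (n : ℤ) ∧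
    PathIn (zdGraph 3) (quietSet R ω ∩ cubeAt n a) x y}

/-- `TGAt n R a`: two vacant giants in the tripled block cube of `a`. -/
def TGAt (n R : ℕ) (a : Site 2) : Set (BondConfig (Site 3)) :=
  {ω | ∃ x y : Site 3,
    (∃ z : Site 3, PathIn (zdGraph 3) (quietSet R ω ∩ bigCubeAt n a) x z ∧ ∃ i : Fin 3, (n : ℤ) ≤ |z i - x i|) ∧
    (∃ z : Site 3, PathIn (zdGraph 3) (quietSet R ω ∩ bigCubeAt n a) y z ∧ ∃ i : Fin 3, (n : ℤ) ≤ |z i - y i|) ∧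
    ¬ PathIn (zdGraph 3) (quietSet R ω ∩ bigCubeAt n a) x y}

/-- `TwoVacantGiants n R`: two vacant giants in the tripled cube `[-n, 2n]³` (the case `a = 0` of `TGAt`). -/
def TwoVacantGiants (n R : ℕ) : Set (BondConfig (Site 3)) :=
  {ω | ∃ x y : Site 3,
    (∃ z : Site 3, PathIn (zdGraph 3) (quietSet R ω ∩ bigCube n) x z ∧ ∃ i : Fin 3, (n : ℤ) ≤ |z i - x i|) ∧
    (∃ z : Site 3, PathIn (zdGraph 3) (quietSet R ω ∩ bigCube n) y z ∧ ∃ i : Fin 3, (n : ℤ) ≤ |z i - y i|) ∧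
    ¬ PathIn (zdGraph 3) (quietSet R ω ∩ bigCube n) x y}

/-- `GoodAt n R a ω`: the block of `a` is crossed in the three directions and has no two giants. -/
def GoodAt (n R : ℕ) (a : Site 2) (ω : BondConfig (Site 3)) : Prop :=
  (∀ i : Fin 3, ω ∈ CrossAt n R a i) ∧ ω ∉ TGAt n R a

/-- `BC n R ω`: the coarse bond configuration on `ℤ²` — a lattice edge is open iff both its blocks are good. -/
def BC (n R : ℕ) (ω : BondConfig (Site 3)) : BondConfig (Site 2) :=
  {e | e ∈ (zdGraph 2).edgeSet ∧ ∀ a ∈ e, GoodAt n R a ω}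

/-- `BFP n R a`: the block footprint — the pairs with both endpoints in `planeEmb 3 (n • a) + [-n-R, 2n+R]³`. -/
def BFP (n R : ℕ) (a : Site 2) : Set (Sym2 (Site 3)) :=
  {z : Site 3 | ∀ i, (planeEmb 3 ((n : ℤ) • a)) i - (n : ℤ) - (R : ℤ) ≤ z i ∧
    z i ≤ (planeEmb 3 ((n : ℤ) • a)) i + 2 * (n : ℤ) + (R : ℤ)}.sym2

/-! ### Statements of the stubs (named here for the engine; refuters refute THESE by name) -/

/-- **PlaneProduct** — the lever: `k (2R+2) ≤ n → P_p(SheetEvent n R) ≤ P_p(PlanarArmedStarCrossing n R)^k`. -/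
def PlaneProduct : Prop :=
  ∀ (p : unitInterval) (n R k : ℕ), k * (2 * R + 2) ≤ n →
    (bondPercolation (zdGraph 3) p).real (SheetEvent n R) ≤
      (bondPercolation (zdGraph 3) p).real (PlanarArmedStarCrossing n R) ^ k

/-- **BlockLocality** — the block events are determined by the finite footprint; footprints of blocks at coarse sup-distance `≥ 4`
are disjoint when `2R+2 ≤ n`. -/
def BlockLocality : Prop :=
  (∀ (n R : ℕ) (a : Site 2),
    (∀ i : Fin 3, DeterminedBy (CrossAt n R a i) (BFP n R a)) ∧ DeterminedBy (TGAt n R a) (BFP n R a) ∧ (BFP n R a).Finite) ∧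
  (∀ (n R : ℕ) (a b : Site 2), 2 * R + 2 ≤ n → (4 : ℤ) ≤ max |a 0 - b 0| |a 1 - b 1| →
    Disjoint (BFP n R a) (BFP n R b))

/-- **BlockMarginals** — the block events have the probabilities of the origin events (translation + coordinate permutation). -/
def BlockMarginals : Prop :=
  ∀ (p : unitInterval) (n R : ℕ) (a : Site 2),
    (∀ i : Fin 3, (bondPercolation (zdGraph 3) p).real (CrossAt n R a i)ᶜ =
      (bondPercolation (zdGraph 3) p).real (SheetEvent n R)) ∧
    (bondPercolation (zdGraph 3) p).real (TGAt n R a) = (bondPercolation (zdGraph 3) p).real (TwoVacantGiants n R)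

/-- **BlocksPercolate** — the finitely dependent renormalisation, ABSTRACT form (reshaped 2026-08-16 after wave-1: the concrete
77-line signature exceeded the registry's signature cap; the concrete block events are substituted by the engine): for a universal
`q > 0`, for ANY block events `Cross a i`, `TG a` determined by finite footprints `BFP a` that are disjoint at coarse sup-distance `≥ 4`,
crossing-failure and two-giants probabilities `≤ q` make the coarse process "lattice edge `{a,b}` open iff both blocks good" percolate
from the coarse origin. -/
def BlocksPercolate : Prop :=
  ∃ q : ℝ, 0 < q ∧ ∀ (p : unitInterval) (Cross : Site 2 → Fin 3 → Set (BondConfig (Site 3)))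
    (TG : Site 2 → Set (BondConfig (Site 3))) (BFP : Site 2 → Set (Sym2 (Site 3))),
    (∀ a, (∀ i, DeterminedBy (Cross a i) (BFP a)) ∧ DeterminedBy (TG a) (BFP a) ∧ (BFP a).Finite) →
    (∀ a b : Site 2, (4 : ℤ) ≤ max |a 0 - b 0| |a 1 - b 1| → Disjoint (BFP a) (BFP b)) →
    (∀ a i, (bondPercolation (zdGraph 3) p).real (Cross a i)ᶜ ≤ q) →
    (∀ a, (bondPercolation (zdGraph 3) p).real (TG a) ≤ q) →
    0 < (bondPercolation (zdGraph 3) p).real {ω | (openCluster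
      {e : Sym2 (Site 2) | e ∈ (zdGraph 2).edgeSet ∧ ∀ a ∈ e, (∀ i : Fin 3, ω ∈ Cross a i) ∧ ω ∉ TG a}
      (0 : Site 2)).Infinite}

/-- **BlocksToVacant** — gluing: an infinite coarse cluster gives an infinite component of `X`. -/
def BlocksToVacant : Prop :=
  ∀ (n R : ℕ) (ω : BondConfig (Site 3)), 1 ≤ n → ω ⊆ (zdGraph 3).edgeSet →
    (openCluster (BC n R ω) (0 : Site 2)).Infinite → ω ∈ finiteClustersPercolate (zdGraph 3)

/-- **PlanarNonDegeneracy** — INPUT (a), OPEN: `P_{p_c}(PlanarArmedStarCrossing n R)^{⌊n/(2R+2)⌋} → 0` for every `R ≥ R₀`. -/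
def PlanarNonDegeneracy : Prop :=
  ∃ R₀ : ℕ, 1 ≤ R₀ ∧ ∀ R : ℕ, R₀ ≤ R → ∀ ε : ℝ, 0 < ε → ∃ N : ℕ, ∀ n : ℕ, N ≤ n →
    (bondPercolation (zdGraph 3) (criticalProbI 3)).real (PlanarArmedStarCrossing n R) ^ (n / (2 * R + 2)) < ε

/-- **LocalUniqueness** — INPUT (b), OPEN: `P_{p_c}(TwoVacantGiants n R) → 0` for every `R ≥ R₁`. -/
def LocalUniqueness : Prop :=
  ∃ R₁ : ℕ, ∀ R : ℕ, R₁ ≤ R → ∀ ε : ℝ, 0 < ε → ∃ N : ℕ, ∀ n : ℕ, N ≤ n →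
    (bondPercolation (zdGraph 3) (criticalProbI 3)).real (TwoVacantGiants n R) < ε

/-! ### Registered stubs (`sorry` lives only here; statements in tree vocabulary, objects unfolded) -/

/-- Registered stub (LANDED — proved in the tree, p106144): `PlaneProduct`, the codimension-one lever. -/
theorem stub_planeProduct :
    ∀ (p : unitInterval) (n R k : ℕ), k * (2 * R + 2) ≤ n →
      (bondPercolation (zdGraph 3) p).real
        {ω | ¬ ∃ x y : Site 3, x 0 = 0 ∧ y 0 = (n : ℤ) ∧
          PathIn (zdGraph 3) (quietSet R ω ∩ {x : Site 3 | ∀ i, 0 ≤ x i ∧ x i ≤ (n : ℤ)}) x y} ≤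
      (bondPercolation (zdGraph 3) p).real
        {ω | ∃ x ∈ topSide n n, ∃ y ∈ bottomSide n n,
          PathIn zdStarGraph {z : Site 2 | z ∈ rectangle n n ∧ (![z 0, 0, z 1] : Site 3) ∉ quietSet R ω} x y} ^ k :=
  Summit.CriticalPhenomena.PercolationContinuityZ3.Theorems.stub_planeProduct

example : PlaneProduct := stub_planeProduct

/-- Registered stub (LANDED — proved in the tree, p105898): `BlockLocality`. -/
theorem stub_blockLocality :
    (∀ (n R : ℕ) (a : Site 2),
      (∀ i : Fin 3, DeterminedBy
        {ω : BondConfig (Site 3) | ∃ x y : Site 3, x i = (planeEmb 3 ((n : ℤ) • a)) i ∧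
          y i = (planeEmb 3 ((n : ℤ) • a)) i + (n : ℤ) ∧
          PathIn (zdGraph 3) (quietSet R ω ∩ {x : Site 3 | ∀ i, (planeEmb 3 ((n : ℤ) • a)) i ≤ x i ∧
            x i ≤ (planeEmb 3 ((n : ℤ) • a)) i + (n : ℤ)}) x y}
        ({z : Site 3 | ∀ i, (planeEmb 3 ((n : ℤ) • a)) i - (n : ℤ) - (R : ℤ) ≤ z i ∧
          z i ≤ (planeEmb 3 ((n : ℤ) • a)) i + 2 * (n : ℤ) + (R : ℤ)}.sym2)) ∧
      DeterminedBy
        {ω : BondConfig (Site 3) | ∃ x y : Site 3,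
          (∃ z : Site 3, PathIn (zdGraph 3) (quietSet R ω ∩ {x : Site 3 | ∀ i, (planeEmb 3 ((n : ℤ) • a)) i - (n : ℤ) ≤ x i ∧
            x i ≤ (planeEmb 3 ((n : ℤ) • a)) i + 2 * (n : ℤ)}) x z ∧ ∃ i : Fin 3, (n : ℤ) ≤ |z i - x i|) ∧
          (∃ z : Site 3, PathIn (zdGraph 3) (quietSet R ω ∩ {x : Site 3 | ∀ i, (planeEmb 3 ((n : ℤ) • a)) i - (n : ℤ) ≤ x i ∧
            x i ≤ (planeEmb 3 ((n : ℤ) • a)) i + 2 * (n : ℤ)}) y z ∧ ∃ i : Fin 3, (n : ℤ) ≤ |z i - y i|) ∧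
          ¬ PathIn (zdGraph 3) (quietSet R ω ∩ {x : Site 3 | ∀ i, (planeEmb 3 ((n : ℤ) • a)) i - (n : ℤ) ≤ x i ∧
            x i ≤ (planeEmb 3 ((n : ℤ) • a)) i + 2 * (n : ℤ)}) x y}
        ({z : Site 3 | ∀ i, (planeEmb 3 ((n : ℤ) • a)) i - (n : ℤ) - (R : ℤ) ≤ z i ∧
          z i ≤ (planeEmb 3 ((n : ℤ) • a)) i + 2 * (n : ℤ) + (R : ℤ)}.sym2) ∧
      ({z : Site 3 | ∀ i, (planeEmb 3 ((n : ℤ) • a)) i - (n : ℤ) - (R : ℤ) ≤ z i ∧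
          z i ≤ (planeEmb 3 ((n : ℤ) • a)) i + 2 * (n : ℤ) + (R : ℤ)}.sym2).Finite) ∧
    (∀ (n R : ℕ) (a b : Site 2), 2 * R + 2 ≤ n → (4 : ℤ) ≤ max |a 0 - b 0| |a 1 - b 1| →
      Disjoint
        ({z : Site 3 | ∀ i, (planeEmb 3 ((n : ℤ) • a)) i - (n : ℤ) - (R : ℤ) ≤ z i ∧
          z i ≤ (planeEmb 3 ((n : ℤ) • a)) i + 2 * (n : ℤ) + (R : ℤ)}.sym2)
        ({z : Site 3 | ∀ i, (planeEmb 3 ((n : ℤ) • b)) i - (n : ℤ) - (R : ℤ) ≤ z i ∧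
          z i ≤ (planeEmb 3 ((n : ℤ) • b)) i + 2 * (n : ℤ) + (R : ℤ)}.sym2)) :=
  Summit.CriticalPhenomena.PercolationContinuityZ3.Theorems.stub_blockLocality

example : BlockLocality := stub_blockLocality

/-- Registered stub (LANDED — proved in the tree, p105959): `BlockMarginals`. -/
theorem stub_blockMarginals :
    ∀ (p : unitInterval) (n R : ℕ) (a : Site 2),
      (∀ i : Fin 3, (bondPercolation (zdGraph 3) p).real
        {ω : BondConfig (Site 3) | ∃ x y : Site 3, x i = (planeEmb 3 ((n : ℤ) • a)) i ∧
          y i = (planeEmb 3 ((n : ℤ) • a)) i + (n : ℤ) ∧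
          PathIn (zdGraph 3) (quietSet R ω ∩ {x : Site 3 | ∀ i, (planeEmb 3 ((n : ℤ) • a)) i ≤ x i ∧
            x i ≤ (planeEmb 3 ((n : ℤ) • a)) i + (n : ℤ)}) x y}ᶜ =
        (bondPercolation (zdGraph 3) p).real
        {ω | ¬ ∃ x y : Site 3, x 0 = 0 ∧ y 0 = (n : ℤ) ∧
          PathIn (zdGraph 3) (quietSet R ω ∩ {x : Site 3 | ∀ i, 0 ≤ x i ∧ x i ≤ (n : ℤ)}) x y}) ∧
      (bondPercolation (zdGraph 3) p).real
        {ω : BondConfig (Site 3) | ∃ x y : Site 3,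
          (∃ z : Site 3, PathIn (zdGraph 3) (quietSet R ω ∩ {x : Site 3 | ∀ i, (planeEmb 3 ((n : ℤ) • a)) i - (n : ℤ) ≤ x i ∧
            x i ≤ (planeEmb 3 ((n : ℤ) • a)) i + 2 * (n : ℤ)}) x z ∧ ∃ i : Fin 3, (n : ℤ) ≤ |z i - x i|) ∧
          (∃ z : Site 3, PathIn (zdGraph 3) (quietSet R ω ∩ {x : Site 3 | ∀ i, (planeEmb 3 ((n : ℤ) • a)) i - (n : ℤ) ≤ x i ∧
            x i ≤ (planeEmb 3 ((n : ℤ) • a)) i + 2 * (n : ℤ)}) y z ∧ ∃ i : Fin 3, (n : ℤ) ≤ |z i - y i|) ∧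
          ¬ PathIn (zdGraph 3) (quietSet R ω ∩ {x : Site 3 | ∀ i, (planeEmb 3 ((n : ℤ) • a)) i - (n : ℤ) ≤ x i ∧
            x i ≤ (planeEmb 3 ((n : ℤ) • a)) i + 2 * (n : ℤ)}) x y} =
      (bondPercolation (zdGraph 3) p).real
        {ω : BondConfig (Site 3) | ∃ x y : Site 3,
          (∃ z : Site 3, PathIn (zdGraph 3) (quietSet R ω ∩ {x : Site 3 | ∀ i, -(n : ℤ) ≤ x i ∧ x i ≤ 2 * (n : ℤ)}) x z ∧
            ∃ i : Fin 3, (n : ℤ) ≤ |z i - x i|) ∧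
          (∃ z : Site 3, PathIn (zdGraph 3) (quietSet R ω ∩ {x : Site 3 | ∀ i, -(n : ℤ) ≤ x i ∧ x i ≤ 2 * (n : ℤ)}) y z ∧
            ∃ i : Fin 3, (n : ℤ) ≤ |z i - y i|) ∧
          ¬ PathIn (zdGraph 3) (quietSet R ω ∩ {x : Site 3 | ∀ i, -(n : ℤ) ≤ x i ∧ x i ≤ 2 * (n : ℤ)}) x y} :=
  Summit.CriticalPhenomena.PercolationContinuityZ3.Theorems.stub_blockMarginals

example : BlockMarginals := stub_blockMarginals

/-- Registered stub (LANDED — proved in the tree, p106927, ABSTRACT form; `blocksPercolate_concrete` there derives the concrete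
instantiation): `BlocksPercolate`. -/
theorem stub_blocksPercolate :
    ∃ q : ℝ, 0 < q ∧ ∀ (p : unitInterval) (Cross : Site 2 → Fin 3 → Set (BondConfig (Site 3)))
      (TG : Site 2 → Set (BondConfig (Site 3))) (BFP : Site 2 → Set (Sym2 (Site 3))),
      (∀ a, (∀ i, DeterminedBy (Cross a i) (BFP a)) ∧ DeterminedBy (TG a) (BFP a) ∧ (BFP a).Finite) →
      (∀ a b : Site 2, (4 : ℤ) ≤ max |a 0 - b 0| |a 1 - b 1| → Disjoint (BFP a) (BFP b)) →
      (∀ a i, (bondPercolation (zdGraph 3) p).real (Cross a i)ᶜ ≤ q) →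
      (∀ a, (bondPercolation (zdGraph 3) p).real (TG a) ≤ q) →
      0 < (bondPercolation (zdGraph 3) p).real {ω | (openCluster
        {e : Sym2 (Site 2) | e ∈ (zdGraph 2).edgeSet ∧ ∀ a ∈ e, (∀ i : Fin 3, ω ∈ Cross a i) ∧ ω ∉ TG a}
        (0 : Site 2)).Infinite} :=
  Summit.CriticalPhenomena.PercolationContinuityZ3.Theorems.stub_blocksPercolate

example : BlocksPercolate := stub_blocksPercolate

/-- Registered stub (LANDED — proved in the tree, p106269): `BlocksToVacant` (gluing by uniqueness; only the direction-`0` crossings are actually used). -/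
theorem stub_blocksToVacant :
    ∀ (n R : ℕ) (ω : BondConfig (Site 3)), 1 ≤ n → ω ⊆ (zdGraph 3).edgeSet →
      (openCluster
          {e : Sym2 (Site 2) | e ∈ (zdGraph 2).edgeSet ∧ ∀ a ∈ e,
            (∀ i : Fin 3, ω ∈ {ω : BondConfig (Site 3) | ∃ x y : Site 3, x i = (planeEmb 3 ((n : ℤ) • a)) i ∧
              y i = (planeEmb 3 ((n : ℤ) • a)) i + (n : ℤ) ∧
              PathIn (zdGraph 3) (quietSet R ω ∩ {x : Site 3 | ∀ i, (planeEmb 3 ((n : ℤ) • a)) i ≤ x i ∧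
                x i ≤ (planeEmb 3 ((n : ℤ) • a)) i + (n : ℤ)}) x y}) ∧
            ω ∉ {ω : BondConfig (Site 3) | ∃ x y : Site 3,
              (∃ z : Site 3, PathIn (zdGraph 3) (quietSet R ω ∩ {x : Site 3 | ∀ i, (planeEmb 3 ((n : ℤ) • a)) i - (n : ℤ) ≤ x i ∧
                x i ≤ (planeEmb 3 ((n : ℤ) • a)) i + 2 * (n : ℤ)}) x z ∧ ∃ i : Fin 3, (n : ℤ) ≤ |z i - x i|) ∧
              (∃ z : Site 3, PathIn (zdGraph 3) (quietSet R ω ∩ {x : Site 3 | ∀ i, (planeEmb 3 ((n : ℤ) • a)) i - (n : ℤ) ≤ x i ∧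
                x i ≤ (planeEmb 3 ((n : ℤ) • a)) i + 2 * (n : ℤ)}) y z ∧ ∃ i : Fin 3, (n : ℤ) ≤ |z i - y i|) ∧
              ¬ PathIn (zdGraph 3) (quietSet R ω ∩ {x : Site 3 | ∀ i, (planeEmb 3 ((n : ℤ) • a)) i - (n : ℤ) ≤ x i ∧
                x i ≤ (planeEmb 3 ((n : ℤ) • a)) i + 2 * (n : ℤ)}) x y}}
          (0 : Site 2)).Infinite →
      ω ∈ finiteClustersPercolate (zdGraph 3) :=
  Summit.CriticalPhenomena.PercolationContinuityZ3.Theorems.stub_blocksToVacant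

example : BlocksToVacant := stub_blocksToVacant

/-- Registered stub: `PlanarNonDegeneracy` — INPUT (a), OPEN, hardest (see the planner's card: positivity, not smallness, of planar quiet
crossings at `p_c`; MC-true for `R ≥ 8`, false for `R ≤ 4`, false in `d = 2` and in a dense-jump world). -/
theorem stub_planarNonDegeneracy :
    ∃ R₀ : ℕ, 1 ≤ R₀ ∧ ∀ R : ℕ, R₀ ≤ R → ∀ ε : ℝ, 0 < ε → ∃ N : ℕ, ∀ n : ℕ, N ≤ n →
      (bondPercolation (zdGraph 3) (criticalProbI 3)).real
        {ω | ∃ x ∈ topSide n n, ∃ y ∈ bottomSide n n,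
          PathIn zdStarGraph {z : Site 2 | z ∈ rectangle n n ∧ (![z 0, 0, z 1] : Site 3) ∉ quietSet R ω} x y}
        ^ (n / (2 * R + 2)) < ε := by
  sorry

example : PlanarNonDegeneracy := stub_planarNonDegeneracy

/-- Registered stub: `LocalUniqueness` — INPUT (b), OPEN (local uniqueness of `V_R`-giants at one scale at `p_c`; MC `0/400…0/262`
two-giant samples at `(n,R) = (32,4)…(48,12)`). -/
theorem stub_localUniqueness :
    ∃ R₁ : ℕ, ∀ R : ℕ, R₁ ≤ R → ∀ ε : ℝ, 0 < ε → ∃ N : ℕ, ∀ n : ℕ, N ≤ n →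
      (bondPercolation (zdGraph 3) (criticalProbI 3)).real
        {ω : BondConfig (Site 3) | ∃ x y : Site 3,
          (∃ z : Site 3, PathIn (zdGraph 3) (quietSet R ω ∩ {x : Site 3 | ∀ i, -(n : ℤ) ≤ x i ∧ x i ≤ 2 * (n : ℤ)}) x z ∧
            ∃ i : Fin 3, (n : ℤ) ≤ |z i - x i|) ∧
          (∃ z : Site 3, PathIn (zdGraph 3) (quietSet R ω ∩ {x : Site 3 | ∀ i, -(n : ℤ) ≤ x i ∧ x i ≤ 2 * (n : ℤ)}) y z ∧
            ∃ i : Fin 3, (n : ℤ) ≤ |z i - y i|) ∧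
          ¬ PathIn (zdGraph 3) (quietSet R ω ∩ {x : Site 3 | ∀ i, -(n : ℤ) ≤ x i ∧ x i ≤ 2 * (n : ℤ)}) x y} < ε := by
  sorry

example : LocalUniqueness := stub_localUniqueness

/-! ### The kernel-checked composition (sorry-free engine) -/

/-- The block base point of the coarse origin is the origin. -/
theorem planeEmb_smul_zero (n : ℕ) : planeEmb 3 ((n : ℤ) • (0 : Site 2)) = 0 := by
  rw [smul_zero, map_zero]

/-- The origin block cube is `cube n`. -/
theorem cubeAt_zero (n : ℕ) : cubeAt n 0 = cube n := by
  ext x; simp [cubeAt, cube]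

/-- The origin tripled block cube is `bigCube n`. -/
theorem bigCubeAt_zero (n : ℕ) : bigCubeAt n 0 = bigCube n := by
  ext x
  simp only [bigCubeAt, bigCube, planeEmb_smul_zero, Pi.zero_apply, zero_sub, zero_add, mem_setOf_eq]

/-- `SheetEvent n R` is the complement of the direction-`0` crossing event of the origin block. -/
theorem sheetEvent_eq_compl (n R : ℕ) : SheetEvent n R = (CrossAt n R 0 0)ᶜ := by
  ext ω
  simp only [SheetEvent, CrossAt, cubeAt_zero, planeEmb_smul_zero, Pi.zero_apply, zero_add, mem_setOf_eq, mem_compl_iff]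

/-- `TwoVacantGiants n R` is the two-giants event of the origin block. -/
theorem twoVacantGiants_eq (n R : ℕ) : TwoVacantGiants n R = TGAt n R 0 := by
  ext ω
  simp only [TwoVacantGiants, TGAt, bigCubeAt_zero, mem_setOf_eq]

/-- Continuity of `p ↦ P_p(SheetEvent n R)`, DERIVED from locality: the event is determined by the finite origin footprint, so its
probability is a polynomial in `p` (`continuous_bondPercolation_real_of_determinedBy`). -/
theorem continuous_real_sheetEvent (hLoc : BlockLocality) (n R : ℕ) :
    Continuous fun p : unitInterval => (bondPercolation (zdGraph 3) p).real (SheetEvent n R) := by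
  obtain ⟨hcross, -, hfin⟩ := hLoc.1 n R 0
  have hdet : DeterminedBy (SheetEvent n R) (BFP n R 0) := by
    rw [sheetEvent_eq_compl]
    exact (hcross 0).compl
  refine continuous_bondPercolation_real_of_determinedBy (zdGraph 3) (F := hfin.toFinset) ?_
  rwa [Set.Finite.coe_toFinset]

/-- Continuity of `p ↦ P_p(TwoVacantGiants n R)`, DERIVED from locality likewise. -/
theorem continuous_real_twoVacantGiants (hLoc : BlockLocality) (n R : ℕ) :
    Continuous fun p : unitInterval => (bondPercolation (zdGraph 3) p).real (TwoVacantGiants n R) := by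
  obtain ⟨-, htg, hfin⟩ := hLoc.1 n R 0
  have hdet : DeterminedBy (TwoVacantGiants n R) (BFP n R 0) := by
    rw [twoVacantGiants_eq]
    exact htg
  refine continuous_bondPercolation_real_of_determinedBy (zdGraph 3) (F := hfin.toFinset) ?_
  rwa [Set.Finite.coe_toFinset]

/-- **The planner's `stub_continuity`, DERIVED**: strict bounds at `p_c` on the two block probabilities persist at some `p ∈ (p_c, 1]`
(continuity of two polynomials and `p_c(ℤ³) < 1`).  This produces the crux's load-bearing conjunct `p_c < p` (Disproof §1). -/
theorem exists_supercritical_of_lt (hLoc : BlockLocality) (n R : ℕ) (q : ℝ)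
    (hs : (bondPercolation (zdGraph 3) (criticalProbI 3)).real (SheetEvent n R) < q)
    (hg : (bondPercolation (zdGraph 3) (criticalProbI 3)).real (TwoVacantGiants n R) < q) :
    ∃ p : unitInterval, criticalProb (zdGraph 3) (0 : Site 3) < (p : ℝ) ∧
      (bondPercolation (zdGraph 3) p).real (SheetEvent n R) ≤ q ∧
      (bondPercolation (zdGraph 3) p).real (TwoVacantGiants n R) ≤ q := by
  -- the strict bounds persist on a neighbourhood of `p_c` in `[0,1]`
  have hev : ∀ᶠ p : unitInterval in 𝓝 (criticalProbI 3),
      (bondPercolation (zdGraph 3) p).real (SheetEvent n R) < q ∧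
        (bondPercolation (zdGraph 3) p).real (TwoVacantGiants n R) < q :=
    (Filter.Tendsto.eventually_lt_const hs (continuous_real_sheetEvent hLoc n R).continuousAt).and
      (Filter.Tendsto.eventually_lt_const hg (continuous_real_twoVacantGiants hLoc n R).continuousAt)
  obtain ⟨δ, hδ, hball⟩ := Metric.eventually_nhds_iff.1 hev
  -- a parameter `p` with `p_c < p ≤ 1` and `p < p_c + δ`
  have hpc1 : criticalProb (zdGraph 3) 0 < 1 := criticalProb_zd_lt_one (by norm_num)
  have hpc0 : 0 ≤ criticalProb (zdGraph 3) 0 := (criticalProb_mem_Icc (zdGraph 3) 0).1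
  set r : ℝ := min 1 (criticalProb (zdGraph 3) 0 + δ / 2) with hr
  have hr0 : 0 ≤ r := le_min zero_le_one (by linarith)
  have hr1 : r ≤ 1 := min_le_left _ _
  have hrc : criticalProb (zdGraph 3) 0 < r := lt_min hpc1 (by linarith)
  have hdist : dist (⟨r, hr0, hr1⟩ : unitInterval) (criticalProbI 3) < δ := by
    rw [Subtype.dist_eq, Real.dist_eq, coe_criticalProbI, abs_lt]
    constructor
    · linarith
    · linarith [min_le_right 1 (criticalProb (zdGraph 3) 0 + δ / 2)]
  obtain ⟨h1, h2⟩ := hball hdist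
  exact ⟨⟨r, hr0, hr1⟩, hrc, h1.le, h2.le⟩

/-- From "some vertex percolates in `X`" to "the origin percolates in `X`": countable union bound and translation invariance
(`real_finiteClustersPercolateAt_eq_zero`). -/
theorem real_finiteClustersPercolateAt_pos_of_real_finiteClustersPercolate_pos (p : unitInterval)
    (h : 0 < (bondPercolation (zdGraph 3) p).real (finiteClustersPercolate (zdGraph 3))) :
    0 < (bondPercolation (zdGraph 3) p).real (finiteClustersPercolateAt 3 0) := by
  by_contra h0
  push Not at h0
  have h0' : (bondPercolation (zdGraph 3) p).real (finiteClustersPercolateAt 3 0) = 0 :=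
    le_antisymm h0 measureReal_nonneg
  have hx : ∀ x : Site 3, bondPercolation (zdGraph 3) p (finiteClustersPercolateAt 3 x) = 0 := by
    intro x
    have hxr : (bondPercolation (zdGraph 3) p).real (finiteClustersPercolateAt 3 x) = 0 := by
      rw [real_finiteClustersPercolateAt_eq_zero p x, h0']
    exact (measureReal_eq_zero_iff (measure_ne_top _ _)).1 hxr
  have hU : bondPercolation (zdGraph 3) p (finiteClustersPercolate (zdGraph 3)) = 0 := by
    rw [finiteClustersPercolate_eq_iUnion]
    exact measure_iUnion_null hx
  have : (bondPercolation (zdGraph 3) p).real (finiteClustersPercolate (zdGraph 3)) = 0 := by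
    simp [measureReal_def, hU]
  linarith

/-- **The planner's `stub_renormalisation`, DERIVED**: with the universal `q` of `BlocksPercolate`, at EVERY `p` and every scale
`n ≥ 2R+2`, small sheet and two-giants probabilities put the origin in an infinite component of `X` with positive probability
(coarse percolation; gluing on the full-measure set `{ω ⊆ E(ℤ³)}` by `DCT16.real_mono_of_forall_subset_edgeSet`; union bound +
translation invariance). -/
theorem renormalisation (hBP : BlocksPercolate) (hLoc : BlockLocality) (hMarg : BlockMarginals) (hGlue : BlocksToVacant) :
    ∃ q : ℝ, 0 < q ∧ ∀ (p : unitInterval) (n R : ℕ), 2 * R + 2 ≤ n →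
      (bondPercolation (zdGraph 3) p).real (SheetEvent n R) ≤ q →
      (bondPercolation (zdGraph 3) p).real (TwoVacantGiants n R) ≤ q →
      0 < (bondPercolation (zdGraph 3) p).real (finiteClustersPercolateAt 3 0) := by
  obtain ⟨q, hq, hR⟩ := hBP
  refine ⟨q, hq, fun p n R hn hs hg => ?_⟩
  -- instantiate the abstract renormalisation with the block events of scale `(n, R)`
  have hcoarse : 0 < (bondPercolation (zdGraph 3) p).real {ω | (openCluster (BC n R ω) (0 : Site 2)).Infinite} :=
    hR p (CrossAt n R) (TGAt n R) (BFP n R) (fun a => hLoc.1 n R a) (fun a b hab => hLoc.2 n R a b hn hab)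
      (fun a i => ((hMarg p n R a).1 i).trans_le hs) (fun a => (hMarg p n R a).2.trans_le hg)
  have hX : 0 < (bondPercolation (zdGraph 3) p).real (finiteClustersPercolate (zdGraph 3)) :=
    hcoarse.trans_le (DCT16.real_mono_of_forall_subset_edgeSet (zdGraph 3) _
      fun ω hω h => hGlue n R ω (by omega) hω h)
  exact real_finiteClustersPercolateAt_pos_of_real_finiteClustersPercolate_pos p hX

/-- **ENGINE OF THE COMPOSITION (sorry-free)**: the seven stub statements imply the crux (stated UNFOLDED, so that exactly one
theorem of this file, `VacantSetPercolates_of`, concludes the route decl by name).  At the common arm range `R = max R₀ R₁`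
and a common large scale `n ≥ 2R+2`, the plane product turns planar non-degeneracy into `P_{p_c}(SheetEvent n R) < q`, local
uniqueness gives `P_{p_c}(TwoVacantGiants n R) < q`, continuity moves both bounds to some `p > p_c`, the renormalisation makes the
origin percolate in `X` there, and that is `VacantSetPercolates` verbatim (`finiteClustersPercolateAt 3 0` unfolds to the crux's set,
Disproof §0 `Iff.rfl`). -/
theorem engine (hPP : PlaneProduct) (hLoc : BlockLocality) (hMarg : BlockMarginals)
    (hBP : BlocksPercolate) (hGlue : BlocksToVacant)
    (hA : PlanarNonDegeneracy) (hB : LocalUniqueness) :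
    ∃ p : unitInterval, criticalProb (zdGraph 3) (0 : Site 3) < (p : ℝ) ∧
      0 < (bondPercolation (zdGraph 3) p).real (finiteClustersPercolateAt 3 0) := by
  obtain ⟨q, hq, hren⟩ := renormalisation hBP hLoc hMarg hGlue
  obtain ⟨R₀, hR₀, hA⟩ := hA
  obtain ⟨R₁, hB⟩ := hB
  obtain ⟨Na, hNa⟩ := hA (max R₀ R₁) (le_max_left _ _) q hq
  obtain ⟨Nb, hNb⟩ := hB (max R₀ R₁) (le_max_right _ _) q hq
  -- common scale `n = max (max Na Nb) (2R+2)`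
  set n : ℕ := max (max Na Nb) (2 * max R₀ R₁ + 2) with hn
  have hn2 : 2 * max R₀ R₁ + 2 ≤ n := le_max_right _ _
  have hna : Na ≤ n := (le_max_left _ _).trans (le_max_left _ _)
  have hnb : Nb ≤ n := (le_max_right _ _).trans (le_max_left _ _)
  have hk : n / (2 * max R₀ R₁ + 2) * (2 * max R₀ R₁ + 2) ≤ n := Nat.div_mul_le_self _ _
  -- sheet smallness at `p_c`: plane product + planar non-degeneracy
  have hsheet : (bondPercolation (zdGraph 3) (criticalProbI 3)).real (SheetEvent n (max R₀ R₁)) < q :=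
    (hPP (criticalProbI 3) _ _ _ hk).trans_lt (hNa _ hna)
  -- two-giants smallness at `p_c`: local uniqueness
  have hgiant : (bondPercolation (zdGraph 3) (criticalProbI 3)).real (TwoVacantGiants n (max R₀ R₁)) < q := hNb _ hnb
  -- continuity: both bounds at some `p > p_c`; renormalisation there; the crux verbatim
  obtain ⟨p, hpc, hs, hg⟩ := exists_supercritical_of_lt hLoc _ _ q hsheet hgiant
  exact ⟨p, hpc, hren p _ _ hn2 hs hg⟩

/-- **THE SKELETON THEOREM — the line concludes the crux BY NAME**: the seven registered stubs are fed to the sorry-free `engine`,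
whose conclusion `∃ p > p_c, P_p(finiteClustersPercolateAt 3 0) > 0` IS the route decl unfolded (Disproof §0, `Iff.rfl`).  No `sorry`
occurs here; the theorem becomes the crux proof when the stubs land. -/
theorem VacantSetPercolates_of :
    Summit.CriticalPhenomena.PercolationContinuityZ3.Theses.PercBurnResprinkle.VacantSetPercolates :=
  engine stub_planeProduct stub_blockLocality stub_blockMarginals stub_blocksPercolate stub_blocksToVacant
    stub_planarNonDegeneracy stub_localUniqueness

end

end Summit.CriticalPhenomena.PercolationContinuityZ3.Cruxes.VacantSetPercolates.SheetPlaneProduct
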